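import Literature.AlgebraicGeometry.Resolution.EmbeddedResolutionExcellentSurfacesHistory
import Literature.AlgebraicGeometry.Resolution.EmbeddedResolutionExcellentSurfacesSequenceComp
import HarnessLib

/-!
# CJS 2020 Thm. 1.4 (sequence form, `𝓑 = ∅`) FROM the construction fact F-72 (Cossart–Jannsen–Saito 2020, Cor. 6.26 / Thm. 6.9 (a))

Topic: `Literature/AlgebraicGeometry/Resolution`. PROVED EDGES between named facts already in the tree; nothing is
vendored. The construction fact `CossartJannsenSaito2020_canonicalSequence_history` (F-72,
`EmbeddedResolutionExcellentSurfacesHistory.lean`: the canonical embedded sequence `S(X, Z, 𝓑)` of CJS Thm. 6.9 (a) is an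
iterate of `Σ^{O,max}`-eliminations, `CJSHistory.IsSigmaOMaxProcess`, with Thm. 6.9 (a)'s printed end clauses) records
EVERY blow-up of the process with exactly the per-step data of the sequence predicate `IsBPermissibleSequenceB` of
`EmbeddedResolutionExcellentSurfacesSequence.lean` (centre `V(C)` regular, `𝓘_{X_j} ≤ C`, permissible image in
`𝒪_{X_j,x}`, n.c. with the boundary, every centre point singular on `X_j` or on the boundary; strict transform
`closure (τ⁻¹(X_j ∖ D))`), the boundary being carried member by member (`CJSHistory.boundaryTransform`, Def. 4.4 (b))
instead of as one set (`τ⁻¹(B_j ∪ D)`). This file proves the bookkeeping identity between the two boundary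
book-keepings and derives:

* `CJSHistory.iUnion_boundaryTransform_eq` — `⋃_j 𝓑'_j = τ⁻¹(⋃_j 𝓑_j ∪ D)` (strict transforms of the old members plus
  the exceptional divisor have the same SUPPORT as the total transform), for a closed boundary with finitely many labels;
* `CJSHistory.IsSigmaOMaxElimination.isBPermissibleSequenceB`, `CJSHistory.IsSigmaOMaxProcess.isBPermissibleSequenceB` —
  a `Σ^{O,max}`-elimination round, resp. the whole process of Cor. 6.26, IS a sequence of complete `𝓑`-permissible
  blow-ups in the sense of `IsBPermissibleSequenceB` (boundary = union of the members);
* `CossartJannsenSaito2020EmbeddedSequenceB.of_canonicalSequence_history` — **F-72 ⟹ CJS Thm. 1.4, sequence form with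
  `𝓑 = ∅`** (`CossartJannsenSaito2020EmbeddedSequenceB`);
* `CossartJannsenSaito2020Embedded.of_canonicalSequence_history` — **F-72 ⟹ F-32** (`CossartJannsenSaito2020Embedded`,
  CJS Thm. 1.4 with `B = ∅` and the p. 7 consequences), through the tree's `CossartJannsenSaito2020EmbeddedSequenceB.embedded`.

So the named-fact DAG of the tree now reads `CossartJannsenSaito2020Embedded ⟸ …EmbeddedSequenceB ⟸ F-72`, all edges
kernel-checked; the trust base of any consumer of F-32 that also holds F-72 is F-72 alone. The general-boundary form
(`CossartJannsenSaito2020EmbeddedSequenceBoundary ⟸ F-72`) needs a presentation of an s.n.c. set by finitely many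
irreducible members and is left to the consumer side (the process lemmas here are stated for an arbitrary start boundary).
Nothing here proves resolution of singularities in positive characteristic. AI-written; weaker than expert review.

## References

* V. Cossart, U. Jannsen, S. Saito, *Desingularization: Invariants and Strategy — Application to Dimension 2*, LNM **2270**
  (2020): Thm. 1.4 (pp. 5–6) and p. 7, Def. 4.4 (b) (p. 54), Def. 6.8 / (6.2) (p. 82), Thm. 6.9 (a) (p. 83), Def. 6.23
  (p. 88), Cor. 6.26 (proof, p. 89). [CossartJannsenSaito2020]
-/

noncomputable section

open CategoryTheory AlgebraicGeometry TopologicalSpace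

namespace Literature.AlgebraicGeometry.Resolution

universe u

open Scheme.IdealSheafData

namespace CJSHistory

/-! ## The two boundary book-keepings agree on supports (Def. 4.4 (b)) -/

/-- **`⋃_j 𝓑'_j = τ⁻¹((⋃_j 𝓑_j) ∪ D)`**: along a blow-up `τ` in the closed centre `D`, the union of the transformed
members (strict transforms `closure (τ⁻¹(B_j ∖ D))` of the old members `j < k`, the exceptional divisor `τ⁻¹(D)` with label
`k`, nothing beyond) is the preimage of the old boundary together with the centre — provided the old boundary is closed and
has no member with label `≥ k`. (Only supports are compared; «`𝓑' = 𝓑̃ ∪ {E}`», Def. 4.4 (b).)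
[cite: CossartJannsenSaito2020, Def. 4.4 (b) (p. 54)] -/
theorem iUnion_boundaryTransform_eq {Z Z' : Scheme.{u}} (τ : Z' ⟶ Z) (B : ℕ → Set Z) (k : ℕ) (D : Set Z)
    (hB : ∀ j, k ≤ j → B j = ∅) (hBc : IsClosed (⋃ j, B j)) (hD : IsClosed D) :
    ⋃ j, boundaryTransform τ B k D j = τ ⁻¹' ((⋃ j, B j) ∪ D) := by
  apply le_antisymm
  · refine Set.iUnion_subset fun j => ?_
    rcases lt_trichotomy j k with hj | rfl | hj
    · rw [boundaryTransform_of_lt τ B k D hj]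
      have hcl : IsClosed (τ ⁻¹' ((⋃ j, B j) ∪ D)) := (hBc.union hD).preimage τ.continuous
      refine closure_minimal ?_ hcl
      intro x hx
      exact Or.inl (Set.mem_iUnion.2 ⟨j, hx.1⟩)
    · rw [boundaryTransform_self]
      exact fun x hx => Or.inr hx
    · rw [boundaryTransform_of_gt τ B k D hj]
      exact Set.empty_subset _
  · intro x hx
    simp only [Set.mem_preimage, Set.mem_union, Set.mem_iUnion] at hx
    rcases hx with ⟨j, hj⟩ | hx
    · have hjk : j < k := by
        by_contra hjk
        rw [hB j (not_lt.1 hjk)] at hj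
        exact hj
      by_cases hxD : τ x ∈ D
      · exact Set.mem_iUnion.2 ⟨k, by rw [boundaryTransform_self]; exact hxD⟩
      · refine Set.mem_iUnion.2 ⟨j, ?_⟩
        rw [boundaryTransform_of_lt τ B k D hjk]
        exact subset_closure ⟨hj, hxD⟩
    · exact Set.mem_iUnion.2 ⟨k, by rw [boundaryTransform_self]; exact hx⟩

/-! ## `Σ^{O,max}`-eliminations and the process of Cor. 6.26 are `𝓑`-permissible sequences -/

/-- **One `Σ^{O,max}`-elimination round is a sequence of complete `𝓑`-permissible blow-ups** (Def. 6.23 (2)/(3) with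
Def. 6.8/(6.2): each step of `IsSigmaOMaxElimination` is a blow-up in a regular centre `V(C) ⊂ X_j`, permissible for `X_j`,
n.c. with the boundary, every point of which is singular on `X_j` or on the boundary — literally the step of
`IsBPermissibleSequenceB` with boundary `⋃_j 𝓑_j`), and the label counter still bounds the members.
[cite: CossartJannsenSaito2020, Def. 6.23 (p. 88), Def. 6.8 / (6.2) (p. 82), Thm. 6.9 (a) (p. 83)] -/
theorem IsSigmaOMaxElimination.isBPermissibleSequenceB {Zr : Scheme.{u}} {Xr : Set Zr} {Br : ℕ → Set Zr} {kr : ℕ}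
    {Or : Zr → Set ℕ} {N : ℕ} {Z' : Scheme.{u}} {ρ : Z' ⟶ Zr} {X' : Set Z'} {B' : ℕ → Set Z'} {k' : ℕ}
    {O' : Z' → Set ℕ} (h : IsSigmaOMaxElimination Xr Br kr Or N ρ X' B' k' O')
    (hBr : ∀ j, kr ≤ j → Br j = ∅) :
    IsBPermissibleSequenceB Xr (⋃ j, Br j) ρ X' (⋃ j, B' j) ∧ ∀ j, k' ≤ j → B' j = ∅ := by
  induction h with
  | refl => exact ⟨IsBPermissibleSequenceB.refl, hBr⟩
  | @blowup Z' Z'' ρ X' B' k' O' h hZreg hBsnc C τ hτ hreg hsub hperm hnc hBsing hmax ih =>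
    obtain ⟨ih₁, ih₂⟩ := ih
    refine ⟨?_, fun j hj => boundaryTransform_of_gt τ B' k' _ (by omega)⟩
    have hstep := IsBPermissibleSequenceB.blowup ih₁ C τ hτ hreg hsub hBsing hperm hnc
    rwa [← iUnion_boundaryTransform_eq τ B' k' (C.support : Set Z') ih₂ hBsnc.isClosed
      C.support.isClosed] at hstep

/-- **The process of Cor. 6.26 is a sequence of complete `𝓑`-permissible blow-ups** («If not we repeat the process, this
time with `(X_1, 𝓑_1, O_1)`, and iterate»: the rounds concatenate, `IsBPermissibleSequenceB.comp`).
[cite: CossartJannsenSaito2020, Cor. 6.26 (proof, p. 89), Def. 6.8 / (6.2) (p. 82)] -/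
theorem IsSigmaOMaxProcess.isBPermissibleSequenceB {Z : Scheme.{u}} {X : Set Z} {B : ℕ → Set Z} {k : ℕ}
    {O : Z → Set ℕ} {N : ℕ} {Z' : Scheme.{u}} {σ : Z' ⟶ Z} {X' : Set Z'} {B' : ℕ → Set Z'} {k' : ℕ}
    {O' : Z' → Set ℕ} (h : IsSigmaOMaxProcess X B k O N σ X' B' k' O') (hB : ∀ j, k ≤ j → B j = ∅) :
    IsBPermissibleSequenceB X (⋃ j, B j) σ X' (⋃ j, B' j) ∧ ∀ j, k' ≤ j → B' j = ∅ := by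
  induction h with
  | refl => exact ⟨IsBPermissibleSequenceB.refl, hB⟩
  | @round Z' Z'' σ X' B' k' O' h hnot ρ X'' B'' k'' O'' hr hdone ih =>
    obtain ⟨ih₁, ih₂⟩ := ih
    obtain ⟨h₁, h₂⟩ := hr.isBPermissibleSequenceB ih₂
    exact ⟨ih₁.comp h₁, h₂⟩

end CJSHistory

open CJSHistory

/-! ## F-72 ⟹ CJS Thm. 1.4 (sequence form, `𝓑 = ∅`) ⟹ F-32 -/

/-- **F-72 ⟹ `CossartJannsenSaito2020EmbeddedSequenceB`** (CJS Thm. 1.4, `𝓑 = ∅`, sequence form with the Thm. 6.9 (a)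
clause): run the construction fact from the empty boundary (no members, counter `0`; the empty set is an s.n.c. divisor
and contains no irreducible component of `X`, components being nonempty); its process is a `𝓑`-permissible sequence
from `(i(X), ∅)` by `IsSigmaOMaxProcess.isBPermissibleSequenceB`, and the printed end clauses are carried verbatim.
[cite: CossartJannsenSaito2020, Thm. 1.4 (pp. 5–6), Thm. 6.9 (a) (p. 83), Cor. 6.26 (p. 89)] -/
theorem CossartJannsenSaito2020EmbeddedSequenceB.of_canonicalSequence_history
    (h : CossartJannsenSaito2020_canonicalSequence_history.{u}) :
    CossartJannsenSaito2020EmbeddedSequenceB.{u} := by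
  intro X Z i _ _ _ hreg hexc hdim
  obtain ⟨Z₁, π, X₁, B₁, k₁, O₁, hproc, -, hZ₁, hπ, hsurj, ⟨U, hU, hiso⟩, hX₁, hB₁, htot, htr⟩ :=
    h X Z i (fun _ => (∅ : Set Z)) 0 hreg hexc hdim
      (by simpa using IsStrictNormalCrossingsDivisor.empty Z)
      (fun _ _ => rfl)
      (fun j hj => absurd hj (Nat.not_lt_zero j))
      (by intro a ha; simp at ha)
      (fun T hT hTB => by
        -- an irreducible component is nonempty, so it is not contained in `i ⁻¹' ⋃ j, ∅ = ∅`
        obtain ⟨t, ht⟩ := hT.1.nonempty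
        simpa using hTB ht)
  obtain ⟨hseq, -⟩ := hproc.isBPermissibleSequenceB (fun _ _ => rfl)
  refine ⟨Z₁, π, X₁, ⋃ j, B₁ j, ?_, hZ₁, hπ, hsurj, ⟨U, ?_, hiso⟩, hX₁, hB₁, ?_, htr⟩
  · simpa using hseq
  · simpa using hU
  · simpa using htot

/-- **F-72 ⟹ F-32** (`CossartJannsenSaito2020Embedded`: CJS Thm. 1.4 with `B = ∅` and the p. 7 consequences), through
`CossartJannsenSaito2020EmbeddedSequenceB.embedded`. [cite: CossartJannsenSaito2020, Thm. 1.4 (pp. 5–6) and p. 7] -/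
theorem CossartJannsenSaito2020Embedded.of_canonicalSequence_history
    (h : CossartJannsenSaito2020_canonicalSequence_history.{u}) :
    CossartJannsenSaito2020Embedded.{u} :=
  (CossartJannsenSaito2020EmbeddedSequenceB.of_canonicalSequence_history h).embedded

end Literature.AlgebraicGeometry.Resolution

end
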